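import Summits.AtomisticToContinuum.HydrodynamicLimit.Theses.AntiMazurCoboundaries
import Summits.AtomisticToContinuum.HydrodynamicLimit.Theorems.BoltzmannGreenKubo.Negative.JointMeasurability
import Summits.AtomisticToContinuum.HydrodynamicLimit.Theorems.BoltzmannGreenKubo.Negative.WindowCovariance

/-!
# Two-level Einstein–Helfand bound for an abstract invariant law (stub S1 of the line `two-level-corrector-ring-defect`)

Crux `AntiMazurCoboundaries.BoltzmannGreenKubo` (stmt-AtomisticToContinuum-13985), registered stub `stub_twoLevelBound`.
Setting: a hard-sphere flow `Φ` on `𝕋³`, a probability law `μ` invariant under every `Φ_t` with `μ Φ.goodᶜ = 0`, measurable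
`F, W, W₂ ∈ L²(μ)`, a window `h > 0`, and the correlation DEFECTS `δ₁(t) = ∫ F·(W∘Φ_t − W) dμ + ∫₀ᵗ C_F`,
`δ₂(t) = ∫ W·(W₂∘Φ_t − W₂) dμ + ∫₀ᵗ C_W` (`C_X(r) = ∫ X · X∘Φ_r dμ`) bounded by `Λ₁, Λ₂` on `[0, h]`; conclusion
`|h²V − 2h∫FW dμ| ≤ κ∫F² + κ⁻¹(2h(κ'∫W² + κ'⁻¹∫W₂²) + 2hΛ₂) + 2hΛ₁`, `V = ∫ (h⁻¹∫₀ʰ F∘Φ_s ds)² dμ`, all `κ, κ' > 0`.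
The `localGibbsLaw`/bounded-`X` templates of `Negative/TimeAverage|WindowCovariance` re-run for `(μ, L²)` data (Cauchy–Schwarz slice
by slice replaces boundedness): stationarity, integrability on `μ ⊗ Leb|[0,h] (⊗ Leb|[0,h])`, the `L²` window identity, the LEVEL
IDENTITY `∫(∫₀ʰX∘Φ_r)² = 2∫₀ʰδ − 2∫₀ʰ∫X·Y∘Φ_t + 2h∫XY` at levels `(F, W)` and `(W, W₂)`. Pure-proof file (stub worker S1).
-/

noncomputable section

namespace Summit.AtomisticToContinuum.HydrodynamicLimit.Theorems

open MeasureTheory ProbabilityTheory Filter Topology Set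
open Literature.Analysis.FluidPDE Literature.MathematicalPhysics.KineticTheory
open Literature.Analysis.UnboundedOperators
open scoped InnerProductSpace ENNReal
open BoltzmannGreenKuboOrthMomentum BoltzmannGreenKuboWindowCovariance

namespace BoltzmannGreenKuboTwoLevelBound

/-- Slice-bound integrability on `μ ⊗ ν`, `ν` finite: all `y`-slices integrable with `∫ ‖f(·, y)‖ dμ ≤ C`. [folklore] -/
theorem integrable_prod_of_norm_integral_le {α β : Type*} [MeasurableSpace α] [MeasurableSpace β]
    {μ : Measure α} {ν : Measure β} [SFinite μ] [IsFiniteMeasure ν] {f : α × β → ℝ}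
    (hf : AEStronglyMeasurable f (μ.prod ν)) (hs : ∀ y, Integrable (fun x => f (x, y)) μ)
    {C : ℝ} (hC : ∀ y, ∫ x, ‖f (x, y)‖ ∂μ ≤ C) : Integrable f (μ.prod ν) := by
  rw [integrable_prod_iff' hf]
  refine ⟨Eventually.of_forall hs, (integrable_const C).mono' hf.prod_swap.norm.integral_prod_right'
    (Eventually.of_forall fun y => ?_)⟩
  rw [Real.norm_eq_abs, abs_of_nonneg (integral_nonneg fun _ => norm_nonneg _)]
  exact hC y

/-- Weighted Young inequality `|a b| ≤ (κ a² + κ⁻¹ b²) / 2` for `κ > 0`. [folklore] -/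
theorem abs_mul_le_half {κ : ℝ} (hκ : 0 < κ) (a b : ℝ) : |a * b| ≤ (κ * a ^ 2 + κ⁻¹ * b ^ 2) / 2 := by
  rw [abs_mul]
  have key : κ * (κ * a ^ 2 + κ⁻¹ * b ^ 2 - 2 * (|a| * |b|)) = (κ * |a| - |b|) ^ 2 := by
    rw [← sq_abs a, ← sq_abs b]
    field_simp
    ring
  have h2 : 0 ≤ κ * (κ * a ^ 2 + κ⁻¹ * b ^ 2 - 2 * (|a| * |b|)) := by rw [key]; exact sq_nonneg _
  have h3 := (mul_nonneg_iff_of_pos_left hκ).1 h2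
  linarith

/-- Weighted Cauchy–Schwarz without square roots: `|∫ X Y dμ| ≤ (κ ∫ X² + κ⁻¹ ∫ Y²) / 2`, `X, Y ∈ L²(μ)`. [folklore] -/
theorem abs_integral_mul_le {α : Type*} [MeasurableSpace α] {μ : Measure α} {X Y : α → ℝ}
    (hX : MemLp X 2 μ) (hY : MemLp Y 2 μ) {κ : ℝ} (hκ : 0 < κ) :
    |∫ z, X z * Y z ∂μ| ≤ (κ * ∫ z, X z ^ 2 ∂μ + κ⁻¹ * ∫ z, Y z ^ 2 ∂μ) / 2 := by
  have hI : Integrable (fun z => (κ * X z ^ 2 + κ⁻¹ * Y z ^ 2) / 2) μ :=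
    ((hX.integrable_sq.const_mul κ).add (hY.integrable_sq.const_mul κ⁻¹)).div_const 2
  calc |∫ z, X z * Y z ∂μ| ≤ ∫ z, |X z * Y z| ∂μ := abs_integral_le_integral_abs
    _ ≤ ∫ z, (κ * X z ^ 2 + κ⁻¹ * Y z ^ 2) / 2 ∂μ :=
        integral_mono_of_nonneg (Eventually.of_forall fun z => abs_nonneg _) hI
          (Eventually.of_forall fun z => abs_mul_le_half hκ _ _)
    _ = (κ * ∫ z, X z ^ 2 ∂μ + κ⁻¹ * ∫ z, Y z ^ 2 ∂μ) / 2 := by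
        rw [integral_div, integral_add (hX.integrable_sq.const_mul κ) (hY.integrable_sq.const_mul κ⁻¹),
          integral_const_mul, integral_const_mul]

/-- `∫ ‖X Y‖ dμ ≤ (∫ X² + ∫ Y²) / 2` for `X, Y ∈ L²(μ)`. [folklore] -/
theorem integral_norm_mul_le {α : Type*} [MeasurableSpace α] {μ : Measure α} {X Y : α → ℝ}
    (hX : MemLp X 2 μ) (hY : MemLp Y 2 μ) : ∫ z, ‖X z * Y z‖ ∂μ ≤ ((∫ z, X z ^ 2 ∂μ) + ∫ z, Y z ^ 2 ∂μ) / 2 := by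
  have hI : Integrable (fun z => (X z ^ 2 + Y z ^ 2) / 2) μ := (hX.integrable_sq.add hY.integrable_sq).div_const 2
  calc ∫ z, ‖X z * Y z‖ ∂μ ≤ ∫ z, (X z ^ 2 + Y z ^ 2) / 2 ∂μ :=
        integral_mono_of_nonneg (Eventually.of_forall fun z => norm_nonneg _) hI
          (Eventually.of_forall fun z => by
            simpa only [Real.norm_eq_abs, one_mul, inv_one] using abs_mul_le_half one_pos (X z) (Y z))
    _ = ((∫ z, X z ^ 2 ∂μ) + ∫ z, Y z ^ 2 ∂μ) / 2 := by rw [integral_div, integral_add hX.integrable_sq hY.integrable_sq]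

/-- `|∫₀ʰ f| ≤ h Λ` when `|f| ≤ Λ` on `[0, h]` (no integrability needed). [folklore] -/
theorem abs_intervalIntegral_le {f : ℝ → ℝ} {h Λ : ℝ} (hh : 0 ≤ h) (hf : ∀ t ∈ Set.Icc (0 : ℝ) h, |f t| ≤ Λ) :
    |∫ t in (0 : ℝ)..h, f t| ≤ h * Λ := by
  have H := intervalIntegral.norm_integral_le_of_norm_le_const (a := (0 : ℝ)) (b := h) (C := Λ) (f := f)
    fun t ht => by
      rw [Real.norm_eq_abs]
      exact hf t (Set.Ioc_subset_Icc_self (by rwa [Set.uIoc_of_le hh] at ht))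
  rw [Real.norm_eq_abs, sub_zero, abs_of_nonneg hh] at H
  linarith

section Flow

variable {N : ℕ} {ε : ℝ} (Φ : HardSphereFlow (Torus.geometry (Fin 3)) ε N) {μ : Measure (Config N (Fin 3) T3)}

/-- A.e. every datum is good when `μ` does not charge the bad set. [folklore] -/
theorem ae_mem_good (hgood : μ Φ.goodᶜ = 0) : ∀ᵐ z ∂μ, z ∈ Φ.good := mem_ae_iff.2 hgood

/-- Invariance of expectations: `∫ f(Φ_t z) dμ = ∫ f dμ`. [folklore] -/
theorem integral_comp_flow (hinv : ∀ t, MeasurePreserving (Φ.flow t) μ μ) {f : Config N (Fin 3) T3 → ℝ}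
    (hf : Measurable f) (t : ℝ) : ∫ z, f (Φ.flow t z) ∂μ = ∫ z, f z ∂μ := by
  have h := integral_map_of_stronglyMeasurable (μ := μ) (Φ.measurable_flow t) hf.stronglyMeasurable
  rw [(hinv t).map_eq] at h
  exact h.symm

/-- Invariance of second moments: `∫ X(Φ_t z)² dμ = ∫ X² dμ`. [folklore] -/
theorem integral_sq_comp_flow (hinv : ∀ t, MeasurePreserving (Φ.flow t) μ μ) {X : Config N (Fin 3) T3 → ℝ}
    (hX : Measurable X) (t : ℝ) : ∫ z, X (Φ.flow t z) ^ 2 ∂μ = ∫ z, X z ^ 2 ∂μ :=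
  integral_comp_flow Φ hinv (hX.pow_const 2) t

/-- `X ∘ Φ_t ∈ L²(μ)` for `X ∈ L²(μ)`. [folklore] -/
theorem memLp_comp_flow (hinv : ∀ t, MeasurePreserving (Φ.flow t) μ μ) {X : Config N (Fin 3) T3 → ℝ}
    (hX2 : MemLp X 2 μ) (t : ℝ) : MemLp (fun z => X (Φ.flow t z)) 2 μ :=
  hX2.comp_measurePreserving (hinv t)

/-- Slice bound `∫ ‖X∘Φ_r · Y∘Φ_t‖ dμ ≤ (∫ X² + ∫ Y²)/2`, and `X∘Φ_r · Y∘Φ_t ∈ L¹(μ)`. [folklore] -/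
theorem integral_norm_comp_flow_mul_le (hinv : ∀ t, MeasurePreserving (Φ.flow t) μ μ) {X Y : Config N (Fin 3) T3 → ℝ}
    (hX : Measurable X) (hY : Measurable Y) (hX2 : MemLp X 2 μ) (hY2 : MemLp Y 2 μ) (r t : ℝ) :
    Integrable (fun z => X (Φ.flow r z) * Y (Φ.flow t z)) μ ∧
      ∫ z, ‖X (Φ.flow r z) * Y (Φ.flow t z)‖ ∂μ ≤ ((∫ z, X z ^ 2 ∂μ) + ∫ z, Y z ^ 2 ∂μ) / 2 := by
  refine ⟨(memLp_comp_flow Φ hinv hX2 r).integrable_mul (memLp_comp_flow Φ hinv hY2 t), ?_⟩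
  have h := integral_norm_mul_le (memLp_comp_flow Φ hinv hX2 r) (memLp_comp_flow Φ hinv hY2 t)
  rwa [integral_sq_comp_flow Φ hinv hX r, integral_sq_comp_flow Φ hinv hY t] at h

/-- Weighted Cauchy–Schwarz with invariance: `|∫ X · Y∘Φ_t dμ| ≤ (κ ∫ X² + κ⁻¹ ∫ Y²)/2`. [folklore] -/
theorem abs_integral_mul_comp_flow_le (hinv : ∀ t, MeasurePreserving (Φ.flow t) μ μ) {X Y : Config N (Fin 3) T3 → ℝ}
    (hY : Measurable Y) (hX2 : MemLp X 2 μ) (hY2 : MemLp Y 2 μ) {κ : ℝ} (hκ : 0 < κ) (t : ℝ) :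
    |∫ z, X z * Y (Φ.flow t z) ∂μ| ≤ (κ * ∫ z, X z ^ 2 ∂μ + κ⁻¹ * ∫ z, Y z ^ 2 ∂μ) / 2 := by
  have h := abs_integral_mul_le hX2 (memLp_comp_flow Φ hinv hY2 t) hκ
  rwa [integral_sq_comp_flow Φ hinv hY t] at h

/-- Two-time stationarity `∫ X(Φ_r z) X(Φ_{r'} z) dμ = C(r' − r)` for ALL real `r, r'` (group law on the conull good set,
invariance). [folklore] -/
theorem integral_mul_flow_flow_sub (hinv : ∀ t, MeasurePreserving (Φ.flow t) μ μ) (hgood : μ Φ.goodᶜ = 0)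
    {X : Config N (Fin 3) T3 → ℝ} (hX : Measurable X) (r r' : ℝ) :
    ∫ z, X (Φ.flow r z) * X (Φ.flow r' z) ∂μ = ∫ z, X z * X (Φ.flow (r' - r) z) ∂μ := by
  have hae : (fun z => X (Φ.flow r z) * X (Φ.flow r' z)) =ᵐ[μ]
      fun z => (fun w => X w * X (Φ.flow (r' - r) w)) (Φ.flow r z) := by
    filter_upwards [ae_mem_good Φ hgood] with z hz
    have key : Φ.flow r' z = Φ.flow (r' - r) (Φ.flow r z) := by
      have := Φ.flow_add (r' - r) r z hz
      rwa [sub_add_cancel] at this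
    simp only [key]
  rw [integral_congr_ae hae]
  exact integral_comp_flow Φ hinv (hX.mul (hX.comp (Φ.measurable_flow _))) r

/-- The stationary covariance is even: `C(−t) = C(t)`. [folklore] -/
theorem integral_mul_flow_neg (hinv : ∀ t, MeasurePreserving (Φ.flow t) μ μ) (hgood : μ Φ.goodᶜ = 0)
    {X : Config N (Fin 3) T3 → ℝ} (hX : Measurable X) (t : ℝ) :
    ∫ z, X z * X (Φ.flow (-t) z) ∂μ = ∫ z, X z * X (Φ.flow t z) ∂μ := by
  have h1 := integral_mul_flow_flow_sub Φ hinv hgood hX t 0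
  have h2 := integral_mul_flow_flow_sub Φ hinv hgood hX 0 t
  rw [zero_sub] at h1; rw [sub_zero] at h2
  rw [← h1, ← h2]
  simp_rw [mul_comm (X (Φ.flow t _))]

/-- Two-time stationarity, normal form `∫ X(Φ_r z) X(Φ_{r'} z) dμ = C(|r' − r|)`. [folklore] -/
theorem integral_mul_flow_flow (hinv : ∀ t, MeasurePreserving (Φ.flow t) μ μ) (hgood : μ Φ.goodᶜ = 0)
    {X : Config N (Fin 3) T3 → ℝ} (hX : Measurable X) (r r' : ℝ) :
    ∫ z, X (Φ.flow r z) * X (Φ.flow r' z) ∂μ = ∫ z, X z * X (Φ.flow |r' - r| z) ∂μ := by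
  rw [integral_mul_flow_flow_sub Φ hinv hgood hX r r']
  rcases le_total r r' with h | h
  · rw [abs_of_nonneg (sub_nonneg.2 h)]
  · rw [abs_of_nonpos (sub_nonpos.2 h), integral_mul_flow_neg Φ hinv hgood hX]

/-- Measurability of `t ↦ ∫ X · Y∘Φ_t dμ` (Bochner integral of the jointly measurable modification `flowMod`). [folklore] -/
theorem measurable_integral_mul_comp_flow [SFinite μ] (hgood : μ Φ.goodᶜ = 0) {X Y : Config N (Fin 3) T3 → ℝ}
    (hX : Measurable X) (hY : Measurable Y) : Measurable fun t => ∫ z, X z * Y (Φ.flow t z) ∂μ := by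
  have hM : Measurable fun p : ℝ × Config N (Fin 3) T3 => X p.2 * Y (flowMod Φ p) :=
    (hX.comp measurable_snd).mul (hY.comp (measurable_flowMod Φ))
  have heq : (fun t => ∫ z, X z * Y (Φ.flow t z) ∂μ) = fun t => ∫ z, X z * Y (flowMod Φ (t, z)) ∂μ := by
    funext t
    refine integral_congr_ae ?_
    filter_upwards [ae_mem_good Φ hgood] with z hz
    rw [flowMod_of_mem Φ hz]
  rw [heq]
  exact hM.stronglyMeasurable.integral_prod_right'.measurable

/-- The one-time integrand `(z, t) ↦ Y(Φ_t z)` is a.e.-strongly measurable on `μ ⊗ ν`. [folklore] -/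
theorem aestronglyMeasurable_comp_flow_prod [SFinite μ] (hgood : μ Φ.goodᶜ = 0) {Y : Config N (Fin 3) T3 → ℝ}
    (hY : Measurable Y) (ν : Measure ℝ) [SFinite ν] :
    AEStronglyMeasurable (fun q : Config N (Fin 3) T3 × ℝ => Y (Φ.flow q.2 q.1)) (μ.prod ν) := by
  refine ⟨fun q => Y (flowMod Φ (q.2, q.1)),
    (hY.comp ((measurable_flowMod Φ).comp (measurable_snd.prodMk measurable_fst))).stronglyMeasurable, ?_⟩
  have hnull : (μ.prod ν) (Φ.goodᶜ ×ˢ (Set.univ : Set ℝ)) = 0 := by rw [Measure.prod_prod, hgood, zero_mul]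
  have hae : ∀ᵐ q ∂(μ.prod ν), q.1 ∈ Φ.good := by
    rw [ae_iff]
    refine measure_mono_null (fun q hq => ?_) hnull
    exact ⟨hq, Set.mem_univ _⟩
  filter_upwards [hae] with q hq
  simp only [flowMod_of_mem Φ hq]

/-- Integrability of `(z, t) ↦ X(Φ_r z) Y(Φ_t z)` on `μ ⊗ Leb|[0,h]` (one time frozen) for `X, Y ∈ L²(μ)`. [folklore] -/
theorem integrable_two_time_fixed [SFinite μ] (hinv : ∀ t, MeasurePreserving (Φ.flow t) μ μ) (hgood : μ Φ.goodᶜ = 0)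
    {X Y : Config N (Fin 3) T3 → ℝ} (hX : Measurable X) (hY : Measurable Y) (hX2 : MemLp X 2 μ) (hY2 : MemLp Y 2 μ)
    (h r : ℝ) : Integrable (fun q : Config N (Fin 3) T3 × ℝ => X (Φ.flow r q.1) * Y (Φ.flow q.2 q.1))
      (μ.prod (volume.restrict (Ioc (0 : ℝ) h))) :=
  integrable_prod_of_norm_integral_le
    (((hX.comp ((Φ.measurable_flow r).comp measurable_fst)).aestronglyMeasurable).mul
      (aestronglyMeasurable_comp_flow_prod Φ hgood hY _))
    (fun t => (integral_norm_comp_flow_mul_le Φ hinv hX hY hX2 hY2 r t).1)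
    (fun t => (integral_norm_comp_flow_mul_le Φ hinv hX hY hX2 hY2 r t).2)

/-- Integrability of the two-time integrand `((z, s), s') ↦ X(Φ_s z) X(Φ_{s'} z)` on `μ ⊗ Leb|[0,h] ⊗ Leb|[0,h]`, `X ∈ L²(μ)`,
`h ≥ 0` (jointly measurable modification; Tonelli + Cauchy–Schwarz slice by slice). [folklore] -/
theorem integrable_two_time [SFinite μ] (hinv : ∀ t, MeasurePreserving (Φ.flow t) μ μ) (hgood : μ Φ.goodᶜ = 0)
    {X : Config N (Fin 3) T3 → ℝ} (hX : Measurable X) (hX2 : MemLp X 2 μ) {h : ℝ} (hh : 0 ≤ h) :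
    Integrable (fun p : (Config N (Fin 3) T3 × ℝ) × ℝ => X (Φ.flow p.1.2 p.1.1) * X (Φ.flow p.2 p.1.1))
      ((μ.prod (volume.restrict (Ioc (0 : ℝ) h))).prod (volume.restrict (Ioc (0 : ℝ) h))) := by
  set ν : Measure ℝ := volume.restrict (Ioc (0 : ℝ) h) with hν
  -- a jointly measurable modification
  have hM : Measurable fun p : (Config N (Fin 3) T3 × ℝ) × ℝ =>
      X (flowMod Φ (p.1.2, p.1.1)) * X (flowMod Φ (p.2, p.1.1)) :=
    (hX.comp ((measurable_flowMod Φ).comp (measurable_fst.snd.prodMk measurable_fst.fst))).mul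
      (hX.comp ((measurable_flowMod Φ).comp (measurable_snd.prodMk measurable_fst.fst)))
  have hnull : ((μ.prod ν).prod ν) ((Φ.goodᶜ ×ˢ (univ : Set ℝ)) ×ˢ (univ : Set ℝ)) = 0 := by
    rw [Measure.prod_prod, Measure.prod_prod, hgood, zero_mul, zero_mul]
  have hae : ∀ᵐ p ∂((μ.prod ν).prod ν), p.1.1 ∈ Φ.good := by
    rw [ae_iff]
    refine measure_mono_null (fun p hp => ?_) hnull
    exact ⟨⟨hp, Set.mem_univ _⟩, Set.mem_univ _⟩
  have hA : AEStronglyMeasurable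
      (fun p : (Config N (Fin 3) T3 × ℝ) × ℝ => X (Φ.flow p.1.2 p.1.1) * X (Φ.flow p.2 p.1.1)) ((μ.prod ν).prod ν) := by
    refine ⟨_, hM.stronglyMeasurable, ?_⟩
    filter_upwards [hae] with p hp
    simp only [flowMod_of_mem Φ hp]
  -- slices and the uniform slice bound
  have hI2 : ∀ s' : ℝ, Integrable (fun q : Config N (Fin 3) T3 × ℝ => X (Φ.flow q.2 q.1) * X (Φ.flow s' q.1))
      (μ.prod ν) := fun s' => by
    simpa only [mul_comm] using integrable_two_time_fixed Φ hinv hgood hX hX hX2 hX2 h s'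
  refine integrable_prod_of_norm_integral_le hA hI2 (C := h * (((∫ z, X z ^ 2 ∂μ) + ∫ z, X z ^ 2 ∂μ) / 2)) fun s' => ?_
  rw [integral_prod_symm _ (hI2 s').norm]
  calc ∫ s, ∫ z, ‖X (Φ.flow s z) * X (Φ.flow s' z)‖ ∂μ ∂ν ≤ ∫ s, (((∫ z, X z ^ 2 ∂μ) + ∫ z, X z ^ 2 ∂μ) / 2) ∂ν :=
        integral_mono_of_nonneg (Eventually.of_forall fun s => integral_nonneg fun z => norm_nonneg _)
          (integrable_const _) (Eventually.of_forall fun s => (integral_norm_comp_flow_mul_le Φ hinv hX hX hX2 hX2 s s').2)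
    _ = h * (((∫ z, X z ^ 2 ∂μ) + ∫ z, X z ^ 2 ∂μ) / 2) := by
        rw [integral_const, smul_eq_mul, hν, measureReal_restrict_apply_univ, Real.volume_real_Ioc_of_le hh, sub_zero]

/-- **The `L²` window identity**: for `X ∈ L²(μ)` measurable and `h ≥ 0` the squared window is integrable and
`∫ (∫₀ʰ X(Φ_r z) dr)² dμ = 2 ∫₀ʰ (h − t) ∫ X · X∘Φ_t dμ dt` (Fubini twice, stationarity, triangle reduction). [folklore] -/
theorem integral_sq_window_eq [IsProbabilityMeasure μ] (hinv : ∀ t, MeasurePreserving (Φ.flow t) μ μ)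
    (hgood : μ Φ.goodᶜ = 0) {X : Config N (Fin 3) T3 → ℝ} (hX : Measurable X) (hX2 : MemLp X 2 μ) {h : ℝ} (hh : 0 ≤ h) :
    Integrable (fun z => (∫ r in (0 : ℝ)..h, X (Φ.flow r z)) ^ 2) μ ∧
      ∫ z, (∫ r in (0 : ℝ)..h, X (Φ.flow r z)) ^ 2 ∂μ = 2 * ∫ t in (0 : ℝ)..h, (h - t) * ∫ z, X z * X (Φ.flow t z) ∂μ := by
  have hI3 := integrable_two_time Φ hinv hgood hX hX2 hh
  have hI2 := integrable_two_time_fixed Φ hinv hgood hX hX hX2 hX2 h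
  have hM : ∀ t, |∫ z, X z * X (Φ.flow t z) ∂μ| ≤ (1 * ∫ z, X z ^ 2 ∂μ + 1⁻¹ * ∫ z, X z ^ 2 ∂μ) / 2 := fun t =>
    abs_integral_mul_comp_flow_le Φ hinv hX hX2 hX2 one_pos t
  have htri := double_integral_abs_eq (measurable_integral_mul_comp_flow Φ hgood hX hX) hM hh
  rw [intervalIntegral.integral_of_le hh]
  simp only [intervalIntegral.integral_of_le hh] at htri
  set ν : Measure ℝ := volume.restrict (Ioc (0 : ℝ) h) with hν
  have h1 : ∀ z, (∫ r in (0 : ℝ)..h, X (Φ.flow r z)) ^ 2 = ∫ r, ∫ r', X (Φ.flow r z) * X (Φ.flow r' z) ∂ν ∂ν := fun z => by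
    rw [sq_intervalIntegral (fun r => X (Φ.flow r z)) 0 h]
    simp only [intervalIntegral.integral_of_le hh, hν]
  simp_rw [h1]
  refine ⟨hI3.integral_prod_left.integral_prod_left, ?_⟩
  have hswap1 : ∫ z, ∫ r, ∫ r', X (Φ.flow r z) * X (Φ.flow r' z) ∂ν ∂ν ∂μ =
      ∫ r, ∫ z, ∫ r', X (Φ.flow r z) * X (Φ.flow r' z) ∂ν ∂μ ∂ν :=
    integral_integral_swap hI3.integral_prod_left
  have hC : ∀ r, ∫ z, ∫ r', X (Φ.flow r z) * X (Φ.flow r' z) ∂ν ∂μ = ∫ r', ∫ z, X z * X (Φ.flow |r' - r| z) ∂μ ∂ν :=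
    fun r => by
      rw [integral_integral_swap (hI2 r)]
      exact integral_congr_ae (Eventually.of_forall fun r' => integral_mul_flow_flow Φ hinv hgood hX r r')
  rw [hswap1]
  simp_rw [hC]
  exact htri

/-- Integrability of `(z, t) ↦ X(z) Y(Φ_t z)` on `μ ⊗ Leb|[0,h]`, hence Fubini
`∫₀ʰ ∫ X(z) Y(Φ_t z) dμ dt = ∫ X(z) (∫₀ʰ Y(Φ_t z) dt) dμ` and integrability of the window `∫₀ʰ Y∘Φ_t dt` (take `X = 1`). [folklore] -/
theorem integral_integral_mul_comp_flow_swap [IsProbabilityMeasure μ] (hinv : ∀ t, MeasurePreserving (Φ.flow t) μ μ)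
    (hgood : μ Φ.goodᶜ = 0) {X Y : Config N (Fin 3) T3 → ℝ} (hX : Measurable X) (hY : Measurable Y)
    (hX2 : MemLp X 2 μ) (hY2 : MemLp Y 2 μ) {h : ℝ} (hh : 0 ≤ h) :
    Integrable (fun z => ∫ t in (0 : ℝ)..h, X z * Y (Φ.flow t z)) μ ∧
      ∫ t in (0 : ℝ)..h, ∫ z, X z * Y (Φ.flow t z) ∂μ = ∫ z, X z * (∫ t in (0 : ℝ)..h, Y (Φ.flow t z)) ∂μ := by
  have hI0 : Integrable (fun q : Config N (Fin 3) T3 × ℝ => X q.1 * Y (Φ.flow q.2 q.1))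
      (μ.prod (volume.restrict (Ioc (0 : ℝ) h))) := by
    refine integrable_prod_of_norm_integral_le
      (((hX.comp measurable_fst).aestronglyMeasurable).mul (aestronglyMeasurable_comp_flow_prod Φ hgood hY _))
      (fun t => hX2.integrable_mul (memLp_comp_flow Φ hinv hY2 t)) (C := ((∫ z, X z ^ 2 ∂μ) + ∫ z, Y z ^ 2 ∂μ) / 2)
      fun t => ?_
    have hb := integral_norm_mul_le hX2 (memLp_comp_flow Φ hinv hY2 t)
    rwa [integral_sq_comp_flow Φ hinv hY t] at hb
  have hI : Integrable (Function.uncurry fun (t : ℝ) (z : Config N (Fin 3) T3) => X z * Y (Φ.flow t z))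
      ((volume.restrict (Ioc (0 : ℝ) h)).prod μ) := hI0.swap
  simp only [intervalIntegral.integral_of_le hh]
  refine ⟨hI0.integral_prod_left, ?_⟩
  rw [integral_integral_swap hI]
  exact integral_congr_ae (Eventually.of_forall fun z => integral_const_mul _ _)

/-- **The level identity**: for `X, Y ∈ L²(μ)` measurable, `h ≥ 0`, `C(r) = ∫ X · X∘Φ_r dμ`, `δ(t) = ∫ X·(Y∘Φ_t − Y) dμ + ∫₀ᵗ C`:
`∫ (∫₀ʰ X∘Φ_r)² dμ = 2∫₀ʰ δ − 2∫₀ʰ ∫ X·Y∘Φ_t dμ dt + 2h ∫ X Y dμ` (window identity + Fubini on the triangle). [folklore] -/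
theorem level_identity [IsProbabilityMeasure μ] (hinv : ∀ t, MeasurePreserving (Φ.flow t) μ μ) (hgood : μ Φ.goodᶜ = 0)
    {X Y : Config N (Fin 3) T3 → ℝ} (hX : Measurable X) (hY : Measurable Y) (hX2 : MemLp X 2 μ) (hY2 : MemLp Y 2 μ)
    {h : ℝ} (hh : 0 ≤ h) :
    ∫ z, (∫ r in (0 : ℝ)..h, X (Φ.flow r z)) ^ 2 ∂μ =
      2 * (∫ t in (0 : ℝ)..h, ((∫ z, X z * (Y (Φ.flow t z) - Y z) ∂μ) + ∫ r in (0 : ℝ)..t, ∫ z, X z * X (Φ.flow r z) ∂μ))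
        - 2 * (∫ t in (0 : ℝ)..h, ∫ z, X z * Y (Φ.flow t z) ∂μ) + 2 * h * ∫ z, X z * Y z ∂μ := by
  obtain ⟨-, hwin⟩ := integral_sq_window_eq Φ hinv hgood hX hX2 hh
  have hCm : Measurable fun t => ∫ z, X z * X (Φ.flow t z) ∂μ := measurable_integral_mul_comp_flow Φ hgood hX hX
  have hCb : ∀ t, |∫ z, X z * X (Φ.flow t z) ∂μ| ≤ (1 * ∫ z, X z ^ 2 ∂μ + 1⁻¹ * ∫ z, X z ^ 2 ∂μ) / 2 := fun t =>
    abs_integral_mul_comp_flow_le Φ hinv hX hX2 hX2 one_pos t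
  rw [hwin, ← integral_primitive_eq hCm hCb hh]
  have hDm : Measurable fun t => ∫ z, X z * Y (Φ.flow t z) ∂μ := measurable_integral_mul_comp_flow Φ hgood hX hY
  have hDb : ∀ t, |∫ z, X z * Y (Φ.flow t z) ∂μ| ≤ (1 * ∫ z, X z ^ 2 ∂μ + 1⁻¹ * ∫ z, Y z ^ 2 ∂μ) / 2 := fun t =>
    abs_integral_mul_comp_flow_le Φ hinv hY hX2 hY2 one_pos t
  have hDi : IntervalIntegrable (fun t => ∫ z, X z * Y (Φ.flow t z) ∂μ) volume 0 h :=
    Literature.Probability.Process.intervalIntegrable_of_bdd hDm hDb 0 h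
  have hPi : IntervalIntegrable (fun u => ∫ t in (0 : ℝ)..u, ∫ z, X z * X (Φ.flow t z) ∂μ) volume 0 h :=
    (intervalIntegral.continuous_primitive
      (fun a b => Literature.Probability.Process.intervalIntegrable_of_bdd hCm hCb a b) 0).intervalIntegrable 0 h
  have h2 : Integrable (fun z => X z * Y z) μ := hX2.integrable_mul hY2
  have hpt : ∀ t, ∫ z, X z * (Y (Φ.flow t z) - Y z) ∂μ = (∫ z, X z * Y (Φ.flow t z) ∂μ) - ∫ z, X z * Y z ∂μ :=
    fun t => by
      have h1 : Integrable (fun z => X z * Y (Φ.flow t z)) μ := hX2.integrable_mul (memLp_comp_flow Φ hinv hY2 t)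
      rw [← integral_sub h1 h2]
      simp only [mul_sub]
  have hsplit : ∫ t in (0 : ℝ)..h, ((∫ z, X z * (Y (Φ.flow t z) - Y z) ∂μ) +
        ∫ r in (0 : ℝ)..t, ∫ z, X z * X (Φ.flow r z) ∂μ) =
      ((∫ t in (0 : ℝ)..h, ∫ z, X z * Y (Φ.flow t z) ∂μ) - h * ∫ z, X z * Y z ∂μ) +
        ∫ u in (0 : ℝ)..h, ∫ t in (0 : ℝ)..u, ∫ z, X z * X (Φ.flow t z) ∂μ := by
    simp_rw [hpt]
    rw [intervalIntegral.integral_add (hDi.sub intervalIntegrable_const) hPi,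
      intervalIntegral.integral_sub hDi intervalIntegrable_const, intervalIntegral.integral_const, smul_eq_mul, sub_zero]
  linarith

end Flow

/-- **S1 · two-level Einstein–Helfand bound (abstract).** For a hard-sphere flow `Φ` on `𝕋³`, a `Φ`-invariant
probability law `μ` not charging the bad set, and `F, W, W₂ ∈ L²(μ)` measurable: with the window variance
`V = ∫ (h⁻¹∫₀ʰ F∘Φ_s)² dμ` and the correlation DEFECTS `δ₁(t) = ∫ F·(W∘Φ_t − W) dμ + ∫₀ᵗ∫ F·F∘Φ_r dμ dr`,
`δ₂(t) =` the same for `(W, W₂)`, bounded by `Λ₁, Λ₂` on `[0, h]`, one has for all `κ, κ' > 0`: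
`|h²V − 2h∫FW dμ| ≤ κ∫F² + κ⁻¹(2h(κ'∫W² + κ'⁻¹∫W₂²) + 2hΛ₂) + 2hΛ₁`.
Registered stub `stub_twoLevelBound` of the line `two-level-corrector-ring-defect` (crux stmt-AtomisticToContinuum-13985),
statement verbatim. [folklore] -/
theorem stub_twoLevelBound :
    ∀ (ε : ℝ) (N : ℕ) (Φ : HardSphereFlow (Torus.geometry (Fin 3)) ε (N + 1))
      (μ : Measure (Config (N + 1) (Fin 3) T3)), IsProbabilityMeasure μ →
      (∀ t, MeasurePreserving (Φ.flow t) μ μ) → μ Φ.goodᶜ = 0 →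
      ∀ (F W W₂ : Config (N + 1) (Fin 3) T3 → ℝ), Measurable F → Measurable W → Measurable W₂ →
      MemLp F 2 μ → MemLp W 2 μ → MemLp W₂ 2 μ →
      ∀ (h Λ₁ Λ₂ : ℝ), 0 < h → 0 ≤ Λ₁ → 0 ≤ Λ₂ →
      (∀ t ∈ Set.Icc (0 : ℝ) h,
        |(∫ z, F z * (W (Φ.flow t z) - W z) ∂μ) +
            ∫ r in (0 : ℝ)..t, ∫ z, F z * F (Φ.flow r z) ∂μ| ≤ Λ₁) →
      (∀ t ∈ Set.Icc (0 : ℝ) h,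
        |(∫ z, W z * (W₂ (Φ.flow t z) - W₂ z) ∂μ) +
            ∫ r in (0 : ℝ)..t, ∫ z, W z * W (Φ.flow r z) ∂μ| ≤ Λ₂) →
      ∀ (κ κ' : ℝ), 0 < κ → 0 < κ' →
      |h ^ 2 * (∫⁻ z, ENNReal.ofReal ((h⁻¹ * ∫ s in (0 : ℝ)..h, F (Φ.flow s z)) ^ 2) ∂μ).toReal
          - 2 * h * ∫ z, F z * W z ∂μ|
        ≤ κ * (∫ z, F z ^ 2 ∂μ)
          + κ⁻¹ * (2 * h * (κ' * (∫ z, W z ^ 2 ∂μ) + κ'⁻¹ * (∫ z, W₂ z ^ 2 ∂μ)) + 2 * h * Λ₂)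
          + 2 * h * Λ₁ := by
  intro ε N Φ μ hμ hinv hgood F W W₂ hF hW hW₂ hF2 hW2 hW₂2 h Λ₁ Λ₂ hh _hΛ₁ _hΛ₂ hδ₁ hδ₂ κ κ' hκ hκ'
  have hh' : (0 : ℝ) ≤ h := hh.le
  -- the squared window of `W` is integrable and the window is a.e.-strongly measurable: the window of `W` is in `L²(μ)`
  obtain ⟨hIW, -⟩ := integral_sq_window_eq Φ hinv hgood hW hW2 hh'
  obtain ⟨hW1, -⟩ := integral_integral_mul_comp_flow_swap Φ hinv hgood measurable_const hW (memLp_const 1) hW2 hh'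
  obtain ⟨hF1, -⟩ := integral_integral_mul_comp_flow_swap Φ hinv hgood measurable_const hF (memLp_const 1) hF2 hh'
  simp only [one_mul] at hW1 hF1
  have hY2 : MemLp (fun z => ∫ t in (0 : ℝ)..h, W (Φ.flow t z)) 2 μ :=
    (memLp_two_iff_integrable_sq hW1.aestronglyMeasurable).2 hIW
  -- `V` as a Bochner integral
  have hV : (∫⁻ z, ENNReal.ofReal ((h⁻¹ * ∫ s in (0 : ℝ)..h, F (Φ.flow s z)) ^ 2) ∂μ).toReal =
      h⁻¹ ^ 2 * ∫ z, (∫ s in (0 : ℝ)..h, F (Φ.flow s z)) ^ 2 ∂μ := by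
    rw [← integral_eq_lintegral_of_nonneg_ae (Eventually.of_forall fun z => sq_nonneg _)
      ((hF1.aestronglyMeasurable.const_mul h⁻¹).pow 2)]
    simp_rw [mul_pow]
    exact integral_const_mul _ _
  have hhA : ∀ A : ℝ, h ^ 2 * (h⁻¹ ^ 2 * A) = A := fun A => by field_simp
  -- level identities
  have hL1 := level_identity Φ hinv hgood hF hW hF2 hW2 hh'
  rw [(integral_integral_mul_comp_flow_swap Φ hinv hgood hF hW hF2 hW2 hh').2] at hL1
  have hL2 := level_identity Φ hinv hgood hW hW₂ hW2 hW₂2 hh'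
  -- bounds
  have hb1 := abs_intervalIntegral_le hh' hδ₁
  have hb2 := abs_intervalIntegral_le hh' hδ₂
  have hFY := abs_integral_mul_le hF2 hY2 hκ
  have hD2 : |∫ t in (0 : ℝ)..h, ∫ z, W z * W₂ (Φ.flow t z) ∂μ| ≤
      h * ((κ' * ∫ z, W z ^ 2 ∂μ + κ'⁻¹ * ∫ z, W₂ z ^ 2 ∂μ) / 2) :=
    abs_intervalIntegral_le hh' fun t _ => abs_integral_mul_comp_flow_le Φ hinv hW₂ hW2 hW₂2 hκ' t
  -- level two: `∫ (∫₀ʰ W∘Φ_t)² dμ ≤ 2h(κ'∫W² + κ'⁻¹∫W₂²) + 2hΛ₂`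
  have hQ : ∫ z, (∫ t in (0 : ℝ)..h, W (Φ.flow t z)) ^ 2 ∂μ ≤
      2 * h * (κ' * (∫ z, W z ^ 2 ∂μ) + κ'⁻¹ * (∫ z, W₂ z ^ 2 ∂μ)) + 2 * h * Λ₂ := by
    rw [hL2]
    obtain ⟨a1, a2⟩ := abs_le.1 hb2
    obtain ⟨b1, b2⟩ := abs_le.1 hD2
    have c2 := (abs_le.1 (abs_integral_mul_le hW2 hW₂2 hκ')).2
    have hc2' := mul_le_mul_of_nonneg_left c2 hh'
    linarith
  have hQ' := mul_le_mul_of_nonneg_left hQ (inv_nonneg.2 hκ.le)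
  -- assemble
  rw [hV, hhA, hL1, abs_le]
  obtain ⟨a1, a2⟩ := abs_le.1 hb1
  obtain ⟨b1, b2⟩ := abs_le.1 hFY
  constructor <;> linarith

end BoltzmannGreenKuboTwoLevelBound

end Summit.AtomisticToContinuum.HydrodynamicLimit.Theorems

end
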